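import Literature.NumberTheory.LFunctions.KadiriDirichletExceptionalZero
import Literature.NumberTheory.LFunctions.LandauPageRealZeros
import Literature.NumberTheory.LFunctions.ZetaZeroFreeRegion
import HarnessLib

/-!
# Kadiri's "at most one exceptional zero modulo `q`" (∃-constant form): PROVED

Topic `Literature/NumberTheory/LFunctions`. Everything in this file is PROVED (theorems only); it
DISCHARGES the named fact `Literature.NumberTheory.LFunctions.Kadiri2018.dirichlet_atMostOneZero`
of `KadiriDirichletExceptionalZero.lean` (statement file untouched):

> there is an absolute `R₀ ≥ 1` such that for every modulus `q ≥ 3`, among ALL Dirichlet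
> characters `χ` mod `q` and all `s ≠ 1` with `Re s ≥ 1 − 1/(R₀ log max(q, q|Im s|))`, the
> product `∏_χ L(s, χ)` has at most one zero (as a pair `(χ, s)`); it is real and belongs to a
> real non-principal character.

This is the classical Landau–Page theorem (Montgomery–Vaughan, *Multiplicative Number Theory I*,
Theorem 11.3 with its Case 4, Theorem 11.7 and Corollary 11.8; Davenport ch. 14), of which the
printed sources of the fact (Kadiri, arXiv:math/0510570 Thm 1.1, `R₀ = 6.3970`; McCurley, J. Number
Theory 19 (1984) Thm 1, `R = 9.645908801`) are EXPLICIT versions. The fact quantifies `R₀`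
existentially, so the inexplicit classical theorem suffices, and every ingredient of the classical
theorem is already PROVED in the tree:

* `Literature.NumberTheory.LFunctions.DirichletZFR.exists_zeroFree` (MV Thm 11.3, Cases 1–3,
  `DirichletLFunctionZeroFreeRegion.lean`): for `χ ≠ χ₀` a zero with
  `Re ρ > 1 − c/(log q + log(|Im ρ| + 4))` is real and `χ` is quadratic;
* `Literature.NumberTheory.LFunctions.DirichletZFR.exists_min_realZeros_le` (MV Thm 11.3, Case 4,
  `LandauPageRealZeros.lean`): two distinct real zeros of one `L(s, χ)`, `χ ≠ χ₀`, have
  `min ≤ 1 − c/(log q + log 4)`;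
* `Literature.NumberTheory.LFunctions.DirichletZFR.exists_landau_sameLevel_min_le` (MV Thm 11.7 /
  Cor 11.8, Landau 1918, ibid.): real zeros of two distinct quadratic `χ₁ ≠ χ₂` mod `q` have
  `min ≤ 1 − c/(log q + log 4)`;
* `Literature.NumberTheory.LFunctions.ClassicalZFRData.zeroFree` applied to
  `Literature.NumberTheory.LFunctions.classicalZFRData_riemannZeta` (de la Vallée-Poussin, MV
  Thm 6.6, `ZetaZeroFreeRegion.lean`): `ζ₁(s) = (s − 1)ζ(s) ≠ 0` for `σ > 1/2`,
  `σ > 1 − c/log(|t| + 4)` — this handles the PRINCIPAL character, whose `L`-function is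
  `ζ(s) ∏_{p ∣ q} (1 − p^{−s})` (Mathlib `DirichletCharacter.LFunctionTrivChar_eq_mul_riemannZeta`);
  the Euler factors vanish only on `Re s = 0`.

The only new work is the change of frame between Kadiri's `log max(q, q|t|)` and the tree's
`log q + log(|t| + 4)`: for `q ≥ 3`, `log q + log(|t| + 4) ≤ (5/2) log max(q, q|t|)`
(`Kadiri2018.ell_le_mul_log_max`; `|t| + 4 ≤ 5 max(1, |t|)` and `log 5 ≤ (3/2) log 3`), so that
`Re s ≥ 1 − 1/(R₀ log max(q, q|t|))` implies `1 − Re s ≤ (5/2)/(R₀ (log q + log(|t| + 4)))`, which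
is `< c/(log q + log(|t|+4))` as soon as `R₀ ≥ 3/c`. We take
`R₀ = 6 + 3/c₁ + 3/c₄ + 3/c₇ + 3/c₀` for the four absolute constants above.

No new definition, no new named fact (D-0026: net debt −1). The conditional derivation from the
explicit FACT `McCurley1984_theorem1` (`Kadiri2018.dirichlet_atMostOneZero_of_mccurley`,
`ZeroFreeRegionUpTo.lean`) is superseded but untouched.

## References

* H. L. Montgomery, R. C. Vaughan, *Multiplicative Number Theory I. Classical Theory*, Cambridge
  Stud. Adv. Math. 97 (2007), §6.1 Theorem 6.6; §11.1 Theorem 11.3; §11.2 Theorem 11.7,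
  Corollary 11.8 (`MontgomeryVaughan2007`).
* H. Kadiri, *An explicit zero-free region for the Dirichlet L-functions*, arXiv:math/0510570,
  Thm 1.1; *Explicit zero-free regions for Dirichlet L-functions*, Mathematika 64 (2018) 445–474
  (`Kadiri2018`).
* K. S. McCurley, *Explicit zero-free regions for Dirichlet L-functions*, J. Number Theory 19
  (1984) 7–32, Theorem 1 (`McCurley1984ZFR`).
-/

noncomputable section

open Complex

namespace Literature.NumberTheory.LFunctions.Kadiri2018

/-! ## Change of frame: `log max(q, q|t|)` versus `log q + log(|t| + 4)` -/

/-- `max(q, q|t|) = q · max(1, |t|)` for `q ≥ 0`. [folklore] -/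
private theorem max_eq_mul_max {q : ℝ} (hq : 0 ≤ q) (t : ℝ) :
    max q (q * |t|) = q * max 1 |t| := by
  rcases le_total 1 |t| with h | h
  · rw [max_eq_right h, max_eq_right]
    simpa using mul_le_mul_of_nonneg_left h hq
  · rw [max_eq_left h, max_eq_left]
    · ring
    · simpa using mul_le_mul_of_nonneg_left h hq

/-- `log 5 ≤ (3/2) log 3` (`25 ≤ 27`). [folklore] -/
private theorem log_five_le : Real.log 5 ≤ 3 / 2 * Real.log 3 := by
  have h25 : Real.log 25 ≤ Real.log 27 := Real.log_le_log (by norm_num) (by norm_num)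
  have h1 : Real.log 25 = 2 * Real.log 5 := by
    rw [show (25 : ℝ) = 5 ^ 2 by norm_num, Real.log_pow]; norm_num
  have h2 : Real.log 27 = 3 * Real.log 3 := by
    rw [show (27 : ℝ) = 3 ^ 3 by norm_num, Real.log_pow]; norm_num
  linarith

/-- **Change of frame.** For `q ≥ 3` and real `t`,
`log q + log(|t| + 4) ≤ (5/2) · log max(q, q|t|)`. Indeed `max(q, q|t|) = q·m` with
`m = max(1, |t|)`, `|t| + 4 ≤ 5m`, and `log 5 ≤ (3/2) log 3 ≤ (3/2) log q`. [folklore] -/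
private theorem ell_le_mul_log_max {q : ℕ} (hq : 3 ≤ q) (t : ℝ) :
    Real.log q + Real.log (|t| + 4) ≤ 5 / 2 * Real.log (max (q : ℝ) ((q : ℝ) * |t|)) := by
  have hq3 : (3 : ℝ) ≤ (q : ℝ) := by exact_mod_cast hq
  have hq0 : (0 : ℝ) < (q : ℝ) := by linarith
  set m : ℝ := max 1 |t| with hm
  have hm1 : 1 ≤ m := le_max_left _ _
  have hm0 : 0 < m := by linarith
  have htm : |t| ≤ m := le_max_right _ _
  have hmax : max (q : ℝ) ((q : ℝ) * |t|) = q * m := max_eq_mul_max hq0.le t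
  rw [hmax, Real.log_mul hq0.ne' hm0.ne']
  have hlogm : 0 ≤ Real.log m := Real.log_nonneg hm1
  have h4 : Real.log (|t| + 4) ≤ Real.log 5 + Real.log m := by
    rw [← Real.log_mul (by norm_num) hm0.ne']
    exact Real.log_le_log (by positivity) (by linarith)
  have hlog3 : Real.log 3 ≤ Real.log q := Real.log_le_log (by norm_num) hq3
  have h5 := log_five_le
  have hlog3pos : 0 < Real.log 3 := Real.log_pos (by norm_num)
  nlinarith

/-- Positivity of the tree's frame `ℒ = log q + log(|t| + 4) ≥ log 4 > 1`. [folklore] -/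
private theorem one_lt_ell (q : ℕ) (t : ℝ) : 1 < Real.log q + Real.log (|t| + 4) := by
  have hq : 0 ≤ Real.log (q : ℝ) := Real.log_natCast_nonneg q
  have h4 : Real.log 4 ≤ Real.log (|t| + 4) :=
    Real.log_le_log (by norm_num) (by linarith [abs_nonneg t])
  have hlog4 : 1 < Real.log 4 := by
    have h := Real.exp_one_lt_d9
    rw [Real.lt_log_iff_exp_lt (by norm_num)]
    linarith
  linarith

/-- **Kadiri's region inside the tree's frame.** If `R₀ > 0`, `q ≥ 3` and
`Re s ≥ 1 − 1/(R₀ log max(q, q|Im s|))` (`Kadiri2018.InRegion R₀ q s`), then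
`1 − Re s ≤ (5/2) / (R₀ · (log q + log(|Im s| + 4)))`. [folklore] -/
private theorem one_sub_re_le_of_inRegion {R₀ : ℝ} (hR : 0 < R₀) {q : ℕ} (hq : 3 ≤ q) {s : ℂ}
    (h : InRegion R₀ q s) :
    1 - s.re ≤ (5 / 2) / (R₀ * (Real.log q + Real.log (|s.im| + 4))) := by
  have hM : 1 < Real.log (max (q : ℝ) ((q : ℝ) * |s.im|)) := by
    simpa using one_lt_mul_log (le_refl (1 : ℝ)) hq s
  have hℒ : 1 < Real.log q + Real.log (|s.im| + 4) := one_lt_ell q s.im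
  have hframe := ell_le_mul_log_max hq s.im
  unfold InRegion at h
  have h1 : 1 - s.re ≤ 1 / (R₀ * Real.log (max (q : ℝ) ((q : ℝ) * |s.im|))) := by linarith
  have h2 : 1 / (R₀ * Real.log (max (q : ℝ) ((q : ℝ) * |s.im|))) ≤
      (5 / 2) / (R₀ * (Real.log q + Real.log (|s.im| + 4))) := by
    rw [div_le_div_iff₀ (by positivity) (by positivity)]
    nlinarith
  exact h1.trans h2

/-- A crude consequence: in Kadiri's region with `R₀ ≥ 6` and `q ≥ 3` one has `Re s > 5/6`
(`log max(q, q|t|) ≥ log 3 > 1`). [folklore] -/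
private theorem re_gt_of_inRegion {R₀ : ℝ} (hR : 6 ≤ R₀) {q : ℕ} (hq : 3 ≤ q) {s : ℂ}
    (h : InRegion R₀ q s) : 5 / 6 < s.re := by
  have hR0 : 0 < R₀ := by linarith
  have hM : 1 < Real.log (max (q : ℝ) ((q : ℝ) * |s.im|)) := by
    simpa using one_lt_mul_log (le_refl (1 : ℝ)) hq s
  unfold InRegion at h
  have h6 : 6 < R₀ * Real.log (max (q : ℝ) ((q : ℝ) * |s.im|)) := by nlinarith
  have : 1 / (R₀ * Real.log (max (q : ℝ) ((q : ℝ) * |s.im|))) < 1 / 6 := by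
    rw [div_lt_div_iff₀ (by positivity) (by norm_num)]
    linarith
  linarith

/-- The comparison of constants: if `0 < c`, `3/c ≤ R₀`, `ℒ > 0` and
`1 − σ ≤ (5/2)/(R₀ ℒ)`, then `1 − c/ℒ < σ`. [folklore] -/
private theorem region_of_le {c R₀ ℒ σ : ℝ} (hc : 0 < c) (hR : 3 / c ≤ R₀) (hℒ : 0 < ℒ)
    (h : 1 - σ ≤ (5 / 2) / (R₀ * ℒ)) : 1 - c / ℒ < σ := by
  have h3c : 0 < 3 / c := by positivity
  have hR0 : 0 < R₀ := lt_of_lt_of_le h3c hR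
  have hcR : 3 ≤ c * R₀ := by
    have : c * (3 / c) = 3 := by field_simp
    nlinarith
  have hlt : (5 / 2) / (R₀ * ℒ) < c / ℒ := by
    rw [div_lt_div_iff₀ (by positivity) hℒ]
    nlinarith
  linarith

/-! ## The principal character -/

/-- **No zero of the principal `L`-function near `1`.** For the principal character mod `q`,
`L(s, χ₀) = ζ(s) ∏_{p ∣ q}(1 − p^{−s})` (`s ≠ 1`); the Euler factors vanish only on `Re s = 0`,
and `ζ(s) ≠ 0` in `σ > 1/2`, `σ > 1 − c₀/log(|t| + 4)` by the classical zero-free region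
(`ClassicalZFRData.zeroFree` for `ζ₁ = (s − 1)ζ(s)`). [cite: MontgomeryVaughan2007, Theorem 6.6] -/
theorem LFunction_one_ne_zero {c₀ : ℝ}
    (H₀ : ∀ s : ℂ, 1 - 1 / 2 < s.re → 1 - c₀ / Real.log (|s.im| + 4) < s.re → riemannZeta₁ s ≠ 0)
    {q : ℕ} [NeZero q] {s : ℂ} (hs1 : s ≠ 1) (hre : 1 / 2 < s.re)
    (hreg : 1 - c₀ / Real.log (|s.im| + 4) < s.re) :
    (1 : DirichletCharacter ℂ q).LFunction s ≠ 0 := by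
  intro hL
  have h := DirichletCharacter.LFunctionTrivChar_eq_mul_riemannZeta (N := q) hs1
  rw [show DirichletCharacter.LFunctionTrivChar q s = (1 : DirichletCharacter ℂ q).LFunction s
    from rfl, hL] at h
  rcases mul_eq_zero.1 h.symm with hprod | hzeta
  · obtain ⟨p, hp, hp0⟩ := Finset.prod_eq_zero_iff.1 hprod
    have hpprime : p.Prime := Nat.prime_of_mem_primeFactors hp
    have hp2 : (2 : ℝ) ≤ (p : ℝ) := by exact_mod_cast hpprime.two_le
    have h1 : (p : ℂ) ^ (-s) = 1 := by linear_combination -hp0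
    have hnorm : ‖(p : ℂ) ^ (-s)‖ = (p : ℝ) ^ (-s).re :=
      Complex.norm_natCast_cpow_of_pos hpprime.pos _
    rw [h1, norm_one, Complex.neg_re] at hnorm
    have hlt : (p : ℝ) ^ (-s.re) < 1 :=
      Real.rpow_lt_one_of_one_lt_of_neg (by linarith) (by linarith)
    linarith
  · have hz1 : riemannZeta₁ s = 0 := by
      have h' := riemannZeta_eq_inv_sub_mul hs1
      rw [hzeta] at h'
      have hne : (s - 1)⁻¹ ≠ 0 := inv_ne_zero (sub_ne_zero.2 hs1)
      rcases mul_eq_zero.1 h'.symm with h'' | h''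
      · exact absurd h'' hne
      · exact h''
    exact H₀ s (by linarith) hreg hz1

/-! ## The discharge -/

/-- **Kadiri 2018 Thm 1.1 / McCurley 1984 Thm 1, ∃-constant form = the Landau–Page theorem
(MV Corollary 11.8): PROVED.** Discharges
`Literature.NumberTheory.LFunctions.Kadiri2018.dirichlet_atMostOneZero` from the tree's proved
MV §6.1 and §11.1–11.2 (`ClassicalZFRData.zeroFree` for `ζ`, `DirichletZFR.exists_zeroFree`,
`DirichletZFR.exists_min_realZeros_le`, `DirichletZFR.exists_landau_sameLevel_min_le`) with
`R₀ = 6 + 3/c₁ + 3/c₄ + 3/c₇ + 3/c₀`.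
[cite: MontgomeryVaughan2007, Theorem 11.3, Theorem 11.7, Corollary 11.8]
[cite: Kadiri2018, Thm 1.1] [cite: McCurley1984ZFR, Theorem 1] -/
theorem dirichlet_atMostOneZero_holds : dirichlet_atMostOneZero := by
  obtain ⟨c₁, hc₁, H₁⟩ := DirichletZFR.exists_zeroFree
  obtain ⟨c₄, hc₄, H₄⟩ := DirichletZFR.exists_min_realZeros_le
  obtain ⟨c₇, hc₇, H₇⟩ := DirichletZFR.exists_landau_sameLevel_min_le
  obtain ⟨c₀, hc₀, H₀⟩ := classicalZFRData_riemannZeta.zeroFree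
  set R₀ : ℝ := 6 + 3 / c₁ + 3 / c₄ + 3 / c₇ + 3 / c₀ with hR₀def
  have h₁ : 0 < 3 / c₁ := by positivity
  have h₄ : 0 < 3 / c₄ := by positivity
  have h₇ : 0 < 3 / c₇ := by positivity
  have h₀ : 0 < 3 / c₀ := by positivity
  have hR6 : 6 ≤ R₀ := by rw [hR₀def]; linarith
  have hR0 : 0 < R₀ := by linarith
  have hRc₁ : 3 / c₁ ≤ R₀ := by rw [hR₀def]; linarith
  have hRc₄ : 3 / c₄ ≤ R₀ := by rw [hR₀def]; linarith
  have hRc₇ : 3 / c₇ ≤ R₀ := by rw [hR₀def]; linarith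
  have hRc₀ : 3 / c₀ ≤ R₀ := by rw [hR₀def]; linarith
  refine ⟨R₀, by linarith, ?_⟩
  intro q _ hq χ₁ χ₂ s₁ s₂ hs₁ hs₂ hr₁ hr₂ hz₁ hz₂
  -- STEP 1 (per zero): the character is quadratic and non-principal, the zero is real.
  have step : ∀ (χ : DirichletCharacter ℂ q) (s : ℂ), s ≠ 1 → InRegion R₀ q s →
      χ.LFunction s = 0 → χ ≠ 1 ∧ χ ^ 2 = 1 ∧ s.im = 0 := by
    intro χ s hs hr hz
    have hb := one_sub_re_le_of_inRegion hR0 hq hr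
    have hℒ : 0 < Real.log q + Real.log (|s.im| + 4) := by linarith [one_lt_ell q s.im]
    have hre : 5 / 6 < s.re := re_gt_of_inRegion hR6 hq hr
    have hχ : χ ≠ 1 := by
      intro hχ1
      subst hχ1
      -- principal character: `ζ`'s zero-free region
      have hb' : 1 - s.re ≤ (5 / 2) / (R₀ * Real.log (|s.im| + 4)) := by
        refine hb.trans ?_
        have hq0 : 0 ≤ Real.log (q : ℝ) := Real.log_natCast_nonneg q
        have hl4 : 0 < Real.log (|s.im| + 4) := by
          have := Real.log_le_log (by norm_num : (0:ℝ) < 4)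
            (by linarith [abs_nonneg s.im] : (4 : ℝ) ≤ |s.im| + 4)
          have h4 : 0 < Real.log 4 := Real.log_pos (by norm_num)
          linarith
        exact div_le_div_of_nonneg_left (by norm_num) (by positivity) (by nlinarith)
      have hl4 : 0 < Real.log (|s.im| + 4) := by
        have := Real.log_le_log (by norm_num : (0:ℝ) < 4)
          (by linarith [abs_nonneg s.im] : (4 : ℝ) ≤ |s.im| + 4)
        have h4 : 0 < Real.log 4 := Real.log_pos (by norm_num)
        linarith
      have hreg₀ : 1 - c₀ / Real.log (|s.im| + 4) < s.re := region_of_le hc₀ hRc₀ hl4 hb'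
      exact LFunction_one_ne_zero H₀ hs (by linarith) hreg₀ hz
    have hreg₁ : 1 - c₁ / (Real.log q + Real.log (|s.im| + 4)) < s.re :=
      region_of_le hc₁ hRc₁ hℒ hb
    exact ⟨hχ, H₁ q χ hχ s hz hreg₁⟩
  obtain ⟨hχ₁, hq₁, him₁⟩ := step χ₁ s₁ hs₁ hr₁ hz₁
  obtain ⟨hχ₂, hq₂, him₂⟩ := step χ₂ s₂ hs₂ hr₂ hz₂
  -- the two zeros as real numbers
  set β₁ : ℝ := s₁.re with hβ₁
  set β₂ : ℝ := s₂.re with hβ₂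
  have hsβ₁ : (β₁ : ℂ) = s₁ := Complex.ext (by simp [hβ₁]) (by simp [him₁])
  have hsβ₂ : (β₂ : ℂ) = s₂ := Complex.ext (by simp [hβ₂]) (by simp [him₂])
  have hzβ₁ : χ₁.LFunction (β₁ : ℂ) = 0 := by rw [hsβ₁]; exact hz₁
  have hzβ₂ : χ₂.LFunction (β₂ : ℂ) = 0 := by rw [hsβ₂]; exact hz₂
  -- both zeros lie to the right of `1 − c/(log q + log 4)` for `c = c₄, c₇`
  have hℒ4 : 0 < Real.log q + Real.log 4 := by
    have := one_lt_ell q 0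
    rw [abs_zero, zero_add] at this
    linarith
  have hb₁ : 1 - β₁ ≤ (5 / 2) / (R₀ * (Real.log q + Real.log 4)) := by
    have := one_sub_re_le_of_inRegion hR0 hq hr₁
    rwa [him₁, abs_zero, zero_add] at this
  have hb₂ : 1 - β₂ ≤ (5 / 2) / (R₀ * (Real.log q + Real.log 4)) := by
    have := one_sub_re_le_of_inRegion hR0 hq hr₂
    rwa [him₂, abs_zero, zero_add] at this
  have hβ₁4 : 1 - c₄ / (Real.log q + Real.log 4) < β₁ := region_of_le hc₄ hRc₄ hℒ4 hb₁
  have hβ₂4 : 1 - c₄ / (Real.log q + Real.log 4) < β₂ := region_of_le hc₄ hRc₄ hℒ4 hb₂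
  have hβ₁7 : 1 - c₇ / (Real.log q + Real.log 4) < β₁ := region_of_le hc₇ hRc₇ hℒ4 hb₁
  have hβ₂7 : 1 - c₇ / (Real.log q + Real.log 4) < β₂ := region_of_le hc₇ hRc₇ hℒ4 hb₂
  refine ⟨?_, him₁, hχ₁, hq₁⟩
  by_cases hχ : χ₁ = χ₂
  · subst hχ
    refine ⟨rfl, ?_⟩
    by_contra hne
    have hβne : β₁ ≠ β₂ := by
      intro h
      exact hne (by rw [← hsβ₁, ← hsβ₂, h])
    have hmin := H₄ q χ₁ hχ₁ β₁ β₂ hzβ₁ hzβ₂ hβne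
    have : 1 - c₄ / (Real.log q + Real.log 4) < min β₁ β₂ := lt_min hβ₁4 hβ₂4
    linarith
  · exfalso
    have hmin := H₇ q χ₁ χ₂ hχ₁ hχ₂ hq₁ hq₂ hχ β₁ β₂ hzβ₁ hzβ₂
    have : 1 - c₇ / (Real.log q + Real.log 4) < min β₁ β₂ := lt_min hβ₁7 hβ₂7
    linarith

end Literature.NumberTheory.LFunctions.Kadiri2018
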